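import Literature.NumberTheory.Automorphic.GLnLeviOrbitalDescentCanonical
import HarnessLib

/-!
# Parabolic descent on `GL_n(F)`, Bochner form, HYPOTHESIS-DRIVEN in the constant — and the canonical-measure corollary
# `∫_{G⧸T} φ(y p y⁻¹) d(ν∕t) = (C ‖det(1−K_p)‖⁻¹ ‖det K_p‖).toReal • ∫_{M⧸T} ∫_{K×U_c} φ(k ((m p m⁻¹) u) k⁻¹) d(κ⊗μ_U) d(ν_M∕t′)` with `C` uniform in `T`

Topic `NumberTheory/Automorphic`; namespace `Literature.NumberTheory.Automorphic`. KERNEL mathematics only: theorems, no definition,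
no named fact, no instance, no `sorry`. Cell `pub/hodgecm-mathlib`, programme P3a, road «D-N6s» brick B2 (d2) (LEAD T7-5 (3)): the Bochner ∕
`orbitalIntegral` reading of ★ B2 (d1) `GLnLeviOrbitalDescentCanonical.exists_lintegral_descConj_quotientMeasure_eq_mul_lintegral_levi`
(Rogawski (1990), Lemma 4.13.1 (a) p. 64: `Φ^G(γ, f) = |D_{G∕M}(γ)|^{−1∕2} Φ^M(γ, f̄^P)`). The passage «`lintegral` identity for all Borel
`F ≥ 0` ⇒ identity of push-forward measures ⇒ Bochner identity for continuous integrable `φ`» is ★ F0P3-p01's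
`GLnLeviOrbitalDescentBochner` (p838326) — here it is factored through the identity AS A HYPOTHESIS, so that it serves ANY constant: the
fixed-torus `C` of ★ D-S1c-β ∕ ★ p838326 and the torus-uniform `C` of ★ B2 (d1) alike.

* §1 `map_descConj_eq_smul_map_levi_of_forall_lintegral` — if `∫⁻_{G⧸T} F(y p y⁻¹) dμ_{G∕T} = w · ∫⁻_{M⧸T} ∫⁻_{K×U_c} F(k ((m p m⁻¹) u) k⁻¹) dμ_{M∕T}`
  for all Borel `F ≥ 0`, then `μ_{G∕T}.map (y ↦ y p y⁻¹) = w • (μ_{M∕T} ⊗ (κ ⊗ μ_U)).map ((z, (k, u)) ↦ k ((z p z⁻¹) u) k⁻¹)` (read on indicators).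
* §1 `integral_descConj_eq_smul_integral_levi_of_map_eq` — from that measure identity with `w ∈ (0, ∞)`: for `φ : GL_n(F) → E` continuous
  (`E` Banach) with `y ↦ φ(y p y⁻¹)` integrable on `G ⧸ T`, the `M ⧸ T`-integrand `z ↦ ∫_{K×U_c} φ(k ((z p z⁻¹) u) k⁻¹)` is integrable and
  `∫_{G⧸T} φ(y p y⁻¹) dμ_{G∕T} = w.toReal • ∫_{M⧸T} ∫_{K×U_c} φ(k ((m p m⁻¹) u) k⁻¹) d(κ⊗μ_U) dμ_{M∕T}` (`integral_map` twice, `integral_smul_measure`,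
  Fubini; proofs adapted from ★ p838326).
* §2 **`exists_integral_descConj_quotientMeasure_eq_smul_integral_levi`** — the CANONICAL corollary: ONE `C ∈ (0, ∞)` (that of ★ B2 (d1),
  depending on `ν, ν_M, μ_{G∕M}, κ, μ_U` only) such that for EVERY closed `T ≤ M`, every Haar inversion-invariant `t` on `T`, every admissible
  `p` and every continuous `φ` with integrable orbital integrand w.r.t. `ν∕t`: integrability on `M ⧸ T` and the Bochner identity with
  `w = C ‖det(1−K_p)‖⁻¹ ‖det K_p‖` and the canonical `ν_M∕t′` — the form the N6 split-place transfer (brick B5) consumes: one test function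
  `φ^H = C · (τ_v δ_P^{1∕2}) · φ^{(P)}` serves every `G`-regular `γ_H`, i.e. every torus `T = G_γ`.

## References
* [Rogawski1990] J. D. Rogawski, *Automorphic Representations of Unitary Groups in Three Variables*, Ann. of Math. Stud. 123 (1990),
  §4.13 Lemma 4.13.1 (a) p. 64 and its proof pp. 64–66; §4.3 (4.3.1) p. 43.
* [Folland1995] G. B. Folland, *A Course in Abstract Harmonic Analysis* (1995), §2.6 Thm. 2.49.
* [DeitmarEchterhoff2014] A. Deitmar, S. Echterhoff, *Principles of Harmonic Analysis*, 2nd ed. (2014), Thm. 1.5.3.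
-/

set_option autoImplicit false

noncomputable section

open scoped MatrixGroups NNReal ENNReal
open MeasureTheory Measure Matrix Topology

namespace Literature.NumberTheory.Automorphic

open Literature.MeasureTheory.Group
open Literature.NumberTheory.GaloisRepresentations.IsNonarchimedeanLocalField

variable (F : Type*) [Field F] [ValuativeRel F] [TopologicalSpace F] [IsNonarchimedeanLocalField F]
  [MeasurableSpace F] [BorelSpace F]
  {n : ℕ} {c : Fin n → Bool} [MeasurableSpace (GL (Fin n) F)] [BorelSpace (GL (Fin n) F)]

/-! ## §1 Hypothesis-driven: `lintegral` identity ⇒ measure identity ⇒ Bochner identity -/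

omit [MeasurableSpace F] [BorelSpace F] in
/-- **From the `lintegral` descent identity to the identity of push-forward measures** (read on indicators): for ANY constant `w`,
any invariant-or-not measures `μ_{G∕T}`, `μ_{M∕T}` (the latter s-finite), `κ` finite and `μ_U` s-finite, if
`∫⁻_{G⧸T} F(y p y⁻¹) dμ_{G∕T} = w ∫⁻_{M⧸T} (∫⁻_{K×U_c} F(k ((m p m⁻¹) u) k⁻¹) d(κ⊗μ_U)) dμ_{M∕T}` for every Borel `F ≥ 0`, then
`μ_{G∕T}.map (y ↦ y p y⁻¹) = w • (μ_{M∕T} ⊗ (κ ⊗ μ_U)).map ((z,(k,u)) ↦ k ((z p z⁻¹) u) k⁻¹)`. (Proof pattern of ★ p838326.)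
[cite: Rogawski1990, §4.13 Lemma 4.13.1 (a) pp. 64–66] [cite: Folland1995, §2.6 Thm. 2.49] -/
theorem map_descConj_eq_smul_map_levi_of_forall_lintegral
    {M : Subgroup (GL (Fin n) F)} {T : Subgroup (GL (Fin n) F)}
    [MeasurableSpace (GL (Fin n) F ⧸ T)] [BorelSpace (GL (Fin n) F ⧸ T)]
    [MeasurableSpace (↥M ⧸ T.subgroupOf M)] [BorelSpace (↥M ⧸ T.subgroupOf M)]
    (μGT : Measure (GL (Fin n) F ⧸ T)) (μMT : Measure (↥M ⧸ T.subgroupOf M)) [SFinite μMT]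
    (κ : Measure ↥(glInt n F)) [IsFiniteMeasure κ] (μN : Measure ↥(unipotentRadicalGL F c)) [SFinite μN]
    (w : ℝ≥0∞) (p : standardParabolicGL F c) (hpM : (p : GL (Fin n) F) ∈ M)
    (hpT : ∀ t ∈ T, t * (p : GL (Fin n) F) = (p : GL (Fin n) F) * t)
    (hdesc : ∀ Fn : GL (Fin n) F → ℝ≥0∞, Measurable Fn →
      ∫⁻ y, descConj (p : GL (Fin n) F) T hpT Fn y ∂μGT =
        w * ∫⁻ z, descConj (⟨(p : GL (Fin n) F), hpM⟩ : ↥M) (T.subgroupOf M)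
              (fun s hs => Subtype.ext (hpT (s : GL (Fin n) F) hs))
              (fun m : ↥M => ∫⁻ q : ↥(glInt n F) × ↥(unipotentRadicalGL F c),
                Fn ((q.1 : GL (Fin n) F) * ((m : GL (Fin n) F) * (q.2 : GL (Fin n) F)) *
                  (q.1 : GL (Fin n) F)⁻¹) ∂(κ.prod μN)) z ∂μMT) :
    μGT.map (descConj (p : GL (Fin n) F) T hpT id) =
      w • (μMT.prod (κ.prod μN)).map (fun zq : (↥M ⧸ T.subgroupOf M) × (↥(glInt n F) × ↥(unipotentRadicalGL F c)) =>
          (zq.2.1 : GL (Fin n) F) *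
            ((descConj (⟨(p : GL (Fin n) F), hpM⟩ : ↥M) (T.subgroupOf M)
                (fun t ht => Subtype.ext (hpT (t : GL (Fin n) F) ht)) Subtype.val zq.1) * (zq.2.2 : GL (Fin n) F)) *
          (zq.2.1 : GL (Fin n) F)⁻¹) := by
  haveI : T2Space F := (isLocalField F).toT2Space
  haveI : SecondCountableTopology F := secondCountableTopology_localField F
  haveI : SecondCountableTopology (Matrix (Fin n) (Fin n) F) := inferInstanceAs (SecondCountableTopology (Fin n → Fin n → F))
  haveI : SecondCountableTopology (Matrix (Fin n) (Fin n) F)ᵐᵒᵖ := MulOpposite.opHomeomorph.symm.secondCountableTopology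
  haveI : SecondCountableTopology (GL (Fin n) F) := Units.isEmbedding_embedProduct.secondCountableTopology
  haveI : BorelSpace ↥(unipotentRadicalGL F c) := Subtype.borelSpace _
  haveI : BorelSpace ↥(glInt n F) := Subtype.borelSpace _
  set pM : ↥M := ⟨(p : GL (Fin n) F), hpM⟩ with hpMdef
  set Ψ : (↥M ⧸ T.subgroupOf M) × (↥(glInt n F) × ↥(unipotentRadicalGL F c)) → GL (Fin n) F :=
    fun zq => (zq.2.1 : GL (Fin n) F) *
      ((descConj pM (T.subgroupOf M) (fun t ht => Subtype.ext (hpT (t : GL (Fin n) F) ht)) Subtype.val zq.1) *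
        (zq.2.2 : GL (Fin n) F)) * (zq.2.1 : GL (Fin n) F)⁻¹ with hΨdef
  have hf : Measurable (descConj (p : GL (Fin n) F) T hpT id) := measurable_descConj _ _ _ measurable_id
  have hval : Measurable (descConj pM (T.subgroupOf M) (fun t ht => Subtype.ext (hpT (t : GL (Fin n) F) ht)) Subtype.val) :=
    measurable_descConj _ _ _ measurable_subtype_coe
  have hΨ : Measurable Ψ :=
    ((measurable_subtype_coe.comp (measurable_fst.comp measurable_snd)).mul
      ((hval.comp measurable_fst).mul (measurable_subtype_coe.comp (measurable_snd.comp measurable_snd)))).mul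
      (measurable_subtype_coe.comp (measurable_fst.comp measurable_snd)).inv
  have hvz : ∀ z, descConj pM (T.subgroupOf M) (fun t ht => Subtype.ext (hpT (t : GL (Fin n) F) ht)) Subtype.val z =
      ((descConj pM (T.subgroupOf M) (fun t ht => Subtype.ext (hpT (t : GL (Fin n) F) ht)) id z : ↥M) : GL (Fin n) F) := fun z => by
    induction z using QuotientGroup.induction_on
    rfl
  refine Measure.ext fun s hs => ?_
  rw [Measure.map_apply hf hs, Measure.smul_apply, Measure.map_apply hΨ hs, smul_eq_mul,
    ← lintegral_indicator_one (hf hs), ← lintegral_indicator_one (hΨ hs)]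
  have h1 := hdesc (s.indicator 1) (measurable_one.indicator hs)
  have hL : (fun y => descConj (p : GL (Fin n) F) T hpT (s.indicator (1 : GL (Fin n) F → ℝ≥0∞)) y) =
      (descConj (p : GL (Fin n) F) T hpT id ⁻¹' s).indicator 1 := by
    funext y
    rw [descConj_eq_comp]
    by_cases h : descConj (p : GL (Fin n) F) T hpT id y ∈ s
    · simp [Set.indicator, h]
    · simp [Set.indicator, h]
  have hR : (Ψ ⁻¹' s).indicator (1 : (↥M ⧸ T.subgroupOf M) × (↥(glInt n F) × ↥(unipotentRadicalGL F c)) → ℝ≥0∞) =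
      fun a => s.indicator (1 : GL (Fin n) F → ℝ≥0∞) (Ψ a) := by
    funext a
    by_cases h : Ψ a ∈ s
    · simp [Set.indicator, h]
    · simp [Set.indicator, h]
  rw [hL] at h1
  have hae : AEMeasurable (fun a => s.indicator (1 : GL (Fin n) F → ℝ≥0∞) (Ψ a)) (μMT.prod (κ.prod μN)) :=
    ((measurable_one.indicator hs).comp hΨ).aemeasurable
  rw [h1, hR, lintegral_prod _ hae]
  congr 1
  refine lintegral_congr fun z => ?_
  rw [descConj_eq_comp _ _ _ (fun m : ↥M => ∫⁻ q : ↥(glInt n F) × ↥(unipotentRadicalGL F c),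
    s.indicator (1 : GL (Fin n) F → ℝ≥0∞) ((q.1 : GL (Fin n) F) * ((m : GL (Fin n) F) * (q.2 : GL (Fin n) F)) * (q.1 : GL (Fin n) F)⁻¹) ∂(κ.prod μN))]
  simp only [Function.comp_apply, hΨdef, hvz]
  rfl

omit [MeasurableSpace F] [BorelSpace F] in
/-- **From the identity of push-forward measures to the Bochner identity**: if
`μ_{G∕T}.map (y ↦ y p y⁻¹) = w • (μ_{M∕T} ⊗ (κ ⊗ μ_U)).map ((z,(k,u)) ↦ k ((z p z⁻¹) u) k⁻¹)` with `w ∈ (0, ∞)`, then for every CONTINUOUS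
`φ : GL_n(F) → E` (`E` Banach) whose orbital integrand `y ↦ φ(y p y⁻¹)` is `μ_{G∕T}`-integrable, the `M ⧸ T`-integrand
`z ↦ ∫_{K×U_c} φ(k ((z p z⁻¹) u) k⁻¹) d(κ⊗μ_U)` is `μ_{M∕T}`-integrable and
`∫_{G⧸T} φ(y p y⁻¹) dμ_{G∕T} = w.toReal • ∫_{M⧸T} ∫_{K×U_c} φ(k ((m p m⁻¹) u) k⁻¹) d(κ⊗μ_U) dμ_{M∕T}`. (Proof pattern of ★ p838326.)
[cite: Rogawski1990, §4.13 Lemma 4.13.1 (a) pp. 64–66] [cite: Folland1995, §2.6 Thm. 2.49] -/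
theorem integral_descConj_eq_smul_integral_levi_of_map_eq
    {M : Subgroup (GL (Fin n) F)} {T : Subgroup (GL (Fin n) F)}
    [MeasurableSpace (GL (Fin n) F ⧸ T)] [BorelSpace (GL (Fin n) F ⧸ T)]
    [MeasurableSpace (↥M ⧸ T.subgroupOf M)] [BorelSpace (↥M ⧸ T.subgroupOf M)]
    (μGT : Measure (GL (Fin n) F ⧸ T)) (μMT : Measure (↥M ⧸ T.subgroupOf M)) [SFinite μMT]
    (κ : Measure ↥(glInt n F)) [IsFiniteMeasure κ] (μN : Measure ↥(unipotentRadicalGL F c)) [SFinite μN]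
    {w : ℝ≥0∞} (hw0 : w ≠ 0) (hwtop : w ≠ ∞) (p : standardParabolicGL F c) (hpM : (p : GL (Fin n) F) ∈ M)
    (hpT : ∀ t ∈ T, t * (p : GL (Fin n) F) = (p : GL (Fin n) F) * t)
    (hmap : μGT.map (descConj (p : GL (Fin n) F) T hpT id) =
      w • (μMT.prod (κ.prod μN)).map (fun zq : (↥M ⧸ T.subgroupOf M) × (↥(glInt n F) × ↥(unipotentRadicalGL F c)) =>
          (zq.2.1 : GL (Fin n) F) *
            ((descConj (⟨(p : GL (Fin n) F), hpM⟩ : ↥M) (T.subgroupOf M)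
                (fun t ht => Subtype.ext (hpT (t : GL (Fin n) F) ht)) Subtype.val zq.1) * (zq.2.2 : GL (Fin n) F)) *
          (zq.2.1 : GL (Fin n) F)⁻¹))
    {E : Type*} [NormedAddCommGroup E] [NormedSpace ℝ E] [CompleteSpace E]
    (φ : GL (Fin n) F → E) (hφc : Continuous φ) (hφi : Integrable (descConj (p : GL (Fin n) F) T hpT φ) μGT) :
    Integrable (descConj (⟨(p : GL (Fin n) F), hpM⟩ : ↥M) (T.subgroupOf M) (fun t ht => Subtype.ext (hpT (t : GL (Fin n) F) ht))
        (fun m : ↥M => ∫ q : ↥(glInt n F) × ↥(unipotentRadicalGL F c),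
          φ ((q.1 : GL (Fin n) F) * ((m : GL (Fin n) F) * (q.2 : GL (Fin n) F)) * (q.1 : GL (Fin n) F)⁻¹) ∂(κ.prod μN))) μMT ∧
    ∫ y, descConj (p : GL (Fin n) F) T hpT φ y ∂μGT =
      w.toReal • ∫ z, descConj (⟨(p : GL (Fin n) F), hpM⟩ : ↥M) (T.subgroupOf M) (fun t ht => Subtype.ext (hpT (t : GL (Fin n) F) ht))
          (fun m : ↥M => ∫ q : ↥(glInt n F) × ↥(unipotentRadicalGL F c),
            φ ((q.1 : GL (Fin n) F) * ((m : GL (Fin n) F) * (q.2 : GL (Fin n) F)) * (q.1 : GL (Fin n) F)⁻¹) ∂(κ.prod μN)) z ∂μMT := by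
  haveI : T2Space F := (isLocalField F).toT2Space
  haveI : SecondCountableTopology F := secondCountableTopology_localField F
  haveI : SecondCountableTopology (Matrix (Fin n) (Fin n) F) := inferInstanceAs (SecondCountableTopology (Fin n → Fin n → F))
  haveI : SecondCountableTopology (Matrix (Fin n) (Fin n) F)ᵐᵒᵖ := MulOpposite.opHomeomorph.symm.secondCountableTopology
  haveI : SecondCountableTopology (GL (Fin n) F) := Units.isEmbedding_embedProduct.secondCountableTopology
  haveI : BorelSpace ↥(unipotentRadicalGL F c) := Subtype.borelSpace _
  haveI : BorelSpace ↥(glInt n F) := Subtype.borelSpace _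
  set f := descConj (p : GL (Fin n) F) T hpT id with hf
  set pM : ↥M := ⟨(p : GL (Fin n) F), hpM⟩ with hpMdef
  set Ψ : (↥M ⧸ T.subgroupOf M) × (↥(glInt n F) × ↥(unipotentRadicalGL F c)) → GL (Fin n) F :=
    fun zq => (zq.2.1 : GL (Fin n) F) *
      ((descConj pM (T.subgroupOf M) (fun t ht => Subtype.ext (hpT (t : GL (Fin n) F) ht)) Subtype.val zq.1) *
        (zq.2.2 : GL (Fin n) F)) * (zq.2.1 : GL (Fin n) F)⁻¹ with hΨdef
  have hfm : Measurable f := measurable_descConj _ _ _ measurable_id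
  have hval : Measurable (descConj pM (T.subgroupOf M) (fun t ht => Subtype.ext (hpT (t : GL (Fin n) F) ht)) Subtype.val) :=
    measurable_descConj _ _ _ measurable_subtype_coe
  have hΨm : Measurable Ψ :=
    ((measurable_subtype_coe.comp (measurable_fst.comp measurable_snd)).mul
      ((hval.comp measurable_fst).mul (measurable_subtype_coe.comp (measurable_snd.comp measurable_snd)))).mul
      (measurable_subtype_coe.comp (measurable_fst.comp measurable_snd)).inv
  have hid : μGT.map f = w • (μMT.prod (κ.prod μN)).map Ψ := hmap
  have hφf : descConj (p : GL (Fin n) F) T hpT φ = φ ∘ f := descConj_eq_comp _ _ _ φ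
  have hφsm : ∀ ν : Measure (GL (Fin n) F), AEStronglyMeasurable φ ν := fun ν => hφc.aestronglyMeasurable
  have hI1 : Integrable φ (μGT.map f) := (integrable_map_measure (hφsm _) hfm.aemeasurable).2 (by rw [← hφf]; exact hφi)
  have hI2 : Integrable φ ((μMT.prod (κ.prod μN)).map Ψ) := by
    rw [hid, integrable_smul_measure hw0 hwtop] at hI1
    exact hI1
  have hI3 : Integrable (φ ∘ Ψ) (μMT.prod (κ.prod μN)) := (integrable_map_measure (hφsm _) hΨm.aemeasurable).1 hI2
  have hinner : (descConj pM (T.subgroupOf M) (fun t ht => Subtype.ext (hpT (t : GL (Fin n) F) ht))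
        (fun m : ↥M => ∫ q : ↥(glInt n F) × ↥(unipotentRadicalGL F c),
          φ ((q.1 : GL (Fin n) F) * ((m : GL (Fin n) F) * (q.2 : GL (Fin n) F)) * (q.1 : GL (Fin n) F)⁻¹) ∂(κ.prod μN))) =
      fun z => ∫ q, (φ ∘ Ψ) (z, q) ∂(κ.prod μN) := by
    have hvz : ∀ z, descConj pM (T.subgroupOf M) (fun t ht => Subtype.ext (hpT (t : GL (Fin n) F) ht)) Subtype.val z =
        ((descConj pM (T.subgroupOf M) (fun t ht => Subtype.ext (hpT (t : GL (Fin n) F) ht)) id z : ↥M) : GL (Fin n) F) := fun z => by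
      induction z using QuotientGroup.induction_on
      rfl
    rw [descConj_eq_comp _ _ _ (fun m : ↥M => ∫ q : ↥(glInt n F) × ↥(unipotentRadicalGL F c),
      φ ((q.1 : GL (Fin n) F) * ((m : GL (Fin n) F) * (q.2 : GL (Fin n) F)) * (q.1 : GL (Fin n) F)⁻¹) ∂(κ.prod μN))]
    funext z
    simp only [Function.comp_apply, hΨdef, hvz]
  refine ⟨?_, ?_⟩
  · rw [hinner]
    exact hI3.integral_prod_left
  · calc ∫ y, descConj (p : GL (Fin n) F) T hpT φ y ∂μGT
        = ∫ y, φ (f y) ∂μGT := by rw [hφf]; rfl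
      _ = ∫ x, φ x ∂(μGT.map f) := (integral_map hfm.aemeasurable (hφsm _)).symm
      _ = ∫ x, φ x ∂(w • (μMT.prod (κ.prod μN)).map Ψ) := by rw [hid]
      _ = w.toReal • ∫ x, φ x ∂((μMT.prod (κ.prod μN)).map Ψ) := integral_smul_measure φ w
      _ = w.toReal • ∫ zq, φ (Ψ zq) ∂(μMT.prod (κ.prod μN)) := by rw [integral_map hΨm.aemeasurable (hφsm _)]
      _ = w.toReal • ∫ zq, (φ ∘ Ψ) zq ∂(μMT.prod (κ.prod μN)) := rfl
      _ = w.toReal • ∫ z, ∫ q, (φ ∘ Ψ) (z, q) ∂(κ.prod μN) ∂μMT := by rw [integral_prod _ hI3]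
      _ = _ := by rw [← hinner]

/-! ## §2 The canonical-measure corollary: one constant for every torus -/

/-- **PARABOLIC DESCENT OF ORBITAL INTEGRALS WITH CANONICAL MEASURES, BOCHNER FORM — the constant is uniform in the torus**
[Rogawski1990, Lemma 4.13.1 (a): `Φ^G(γ, f) = |D_{G∕M}(γ)|^{−1∕2} Φ^M(γ, f̄^P)` with the compatible measures of §4.3]: with the binders of ★ B2 (d1)
there is ONE `C ∈ (0, ∞)` such that for EVERY closed `T ≤ M`, every Haar inversion-invariant `t` on `T` (`t′` its transport to `T ⊓ M`), every
`p ∈ P_c ∩ M` centralised by `T` with `det(1 − K_p) ≠ 0` and every CONTINUOUS `φ : GL_n(F) → E` with `y ↦ φ(y p y⁻¹)` integrable for `ν∕t`: the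
`M ⧸ T`-side integrand is `ν_M∕t′`-integrable and
`∫_{G⧸T} φ(y p y⁻¹) d(ν∕t) = (C ‖det(1−K_p)‖⁻¹ ‖det K_p‖).toReal • ∫_{M⧸T} ∫_{K×U_c} φ(k ((m p m⁻¹) u) k⁻¹) d(κ⊗μ_U) d(ν_M∕t′)`.
[cite: Rogawski1990, §4.13 Lemma 4.13.1 (a) pp. 64–66; §4.3 (4.3.1) p. 43] [cite: DeitmarEchterhoff2014, Thm. 1.5.3] [cite: Folland1995, §2.6 Thm. 2.49] -/
theorem exists_integral_descConj_quotientMeasure_eq_smul_integral_levi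
    [T2Space (GL (Fin n) F)] [SecondCountableTopology (GL (Fin n) F)] [LocallyCompactSpace (GL (Fin n) F)]
    (hc : Monotone c) {M : Subgroup (GL (Fin n) F)} (hM : M = standardLeviGL F c) [LocallyCompactSpace ↥M]
    [MeasurableSpace (GL (Fin n) F ⧸ M)] [BorelSpace (GL (Fin n) F ⧸ M)]
    (ν : Measure (GL (Fin n) F)) [IsHaarMeasure ν] [ν.IsMulRightInvariant]
    (νM : Measure ↥M) [IsHaarMeasure νM] [νM.IsMulRightInvariant]
    (μGM : Measure (GL (Fin n) F ⧸ M)) [SMulInvariantMeasure (GL (Fin n) F) (GL (Fin n) F ⧸ M) μGM]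
    [IsFiniteMeasureOnCompacts μGM] (hGM : μGM ≠ 0)
    (κ : Measure ↥(glInt n F)) [IsHaarMeasure κ]
    (μN : Measure ↥(unipotentRadicalGL F c)) [IsHaarMeasure μN] [SFinite μN] :
    ∃ C : ℝ≥0∞, C ≠ 0 ∧ C ≠ ∞ ∧ ∀ (T : Subgroup (GL (Fin n) F)) (hT : IsClosed (T : Set (GL (Fin n) F))) (hTM : T ≤ M)
      [MeasurableSpace (GL (Fin n) F ⧸ T)] [BorelSpace (GL (Fin n) F ⧸ T)]
      [MeasurableSpace (↥M ⧸ T.subgroupOf M)] [BorelSpace (↥M ⧸ T.subgroupOf M)]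
      (t : Measure ↥T) [IsHaarMeasure t] [t.IsInvInvariant]
      (t' : Measure ↥(T.subgroupOf M)) [IsHaarMeasure t'] [t'.IsInvInvariant] [SFinite t']
      (_ht' : t' = Measure.map (Subgroup.subgroupOfEquivOfLe hTM).symm t)
      (p : standardParabolicGL F c) (hpM : (p : GL (Fin n) F) ∈ M)
      (hpT : ∀ s ∈ T, s * (p : GL (Fin n) F) = (p : GL (Fin n) F) * s)
      (_hp : (1 - Matrix.of fun q q' : {i : Fin n // c i = false} × {j : Fin n // c j = true} =>
          ((p : GL (Fin n) F) : Matrix (Fin n) (Fin n) F) q.1 q'.1 *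
            (((p⁻¹ : standardParabolicGL F c) : GL (Fin n) F) : Matrix (Fin n) (Fin n) F) q'.2 q.2).det
          ≠ 0)
      {E : Type*} [NormedAddCommGroup E] [NormedSpace ℝ E] [CompleteSpace E]
      (φ : GL (Fin n) F → E), Continuous φ →
      Integrable (descConj (p : GL (Fin n) F) T hpT φ) (quotientMeasure T t hT ν) →
      Integrable (descConj (⟨(p : GL (Fin n) F), hpM⟩ : ↥M) (T.subgroupOf M) (fun s hs => Subtype.ext (hpT (s : GL (Fin n) F) hs))
          (fun m : ↥M => ∫ q : ↥(glInt n F) × ↥(unipotentRadicalGL F c),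
            φ ((q.1 : GL (Fin n) F) * ((m : GL (Fin n) F) * (q.2 : GL (Fin n) F)) * (q.1 : GL (Fin n) F)⁻¹) ∂(κ.prod μN)))
          (quotientMeasure (T.subgroupOf M) t' (isClosed_subgroupOf T M hT) νM) ∧
      ∫ y, descConj (p : GL (Fin n) F) T hpT φ y ∂(quotientMeasure T t hT ν) =
        (C * ((normAbs F ((1 - Matrix.of
              fun q q' : {i : Fin n // c i = false} × {j : Fin n // c j = true} =>
                ((p : GL (Fin n) F) : Matrix (Fin n) (Fin n) F) q.1 q'.1 *
                  (((p⁻¹ : standardParabolicGL F c) : GL (Fin n) F) : Matrix (Fin n) (Fin n) F)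
                    q'.2 q.2).det)⁻¹ *
            normAbs F (Matrix.of
              fun q q' : {i : Fin n // c i = false} × {j : Fin n // c j = true} =>
                ((p : GL (Fin n) F) : Matrix (Fin n) (Fin n) F) q.1 q'.1 *
                  (((p⁻¹ : standardParabolicGL F c) : GL (Fin n) F) : Matrix (Fin n) (Fin n) F)
                    q'.2 q.2).det : ℝ≥0) : ℝ≥0∞)).toReal •
        ∫ z, descConj (⟨(p : GL (Fin n) F), hpM⟩ : ↥M) (T.subgroupOf M) (fun s hs => Subtype.ext (hpT (s : GL (Fin n) F) hs))
          (fun m : ↥M => ∫ q : ↥(glInt n F) × ↥(unipotentRadicalGL F c),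
            φ ((q.1 : GL (Fin n) F) * ((m : GL (Fin n) F) * (q.2 : GL (Fin n) F)) * (q.1 : GL (Fin n) F)⁻¹) ∂(κ.prod μN)) z
          ∂(quotientMeasure (T.subgroupOf M) t' (isClosed_subgroupOf T M hT) νM) := by
  obtain ⟨C, hC0, hCtop, hdesc⟩ :=
    exists_lintegral_descConj_quotientMeasure_eq_mul_lintegral_levi F hc hM ν νM μGM hGM κ μN
  refine ⟨C, hC0, hCtop, fun T hT hTM _ _ _ _ t _ _ t' _ _ _ ht' p hpM hpT hp E _ _ _ φ hφc hφi => ?_⟩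
  haveI : T2Space F := (isLocalField F).toT2Space
  haveI : CompactSpace ↥(glInt n F) := isCompact_iff_compactSpace.1 (isCompact_glInt n F)
  haveI : BorelSpace ↥(glInt n F) := Subtype.borelSpace _
  haveI : IsFiniteMeasure κ := CompactSpace.isFiniteMeasure
  haveI : SFinite (quotientMeasure (T.subgroupOf M) t' (isClosed_subgroupOf T M hT) νM) := inferInstance
  -- the full constant `w = C ‖det(1−K_p)‖⁻¹ ‖det K_p‖`
  have hw0 : C * ((normAbs F ((1 - Matrix.of
              fun q q' : {i : Fin n // c i = false} × {j : Fin n // c j = true} =>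
                ((p : GL (Fin n) F) : Matrix (Fin n) (Fin n) F) q.1 q'.1 *
                  (((p⁻¹ : standardParabolicGL F c) : GL (Fin n) F) : Matrix (Fin n) (Fin n) F)
                    q'.2 q.2).det)⁻¹ *
            normAbs F (Matrix.of
              fun q q' : {i : Fin n // c i = false} × {j : Fin n // c j = true} =>
                ((p : GL (Fin n) F) : Matrix (Fin n) (Fin n) F) q.1 q'.1 *
                  (((p⁻¹ : standardParabolicGL F c) : GL (Fin n) F) : Matrix (Fin n) (Fin n) F)
                    q'.2 q.2).det : ℝ≥0) : ℝ≥0∞) ≠ 0 := by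
    refine mul_ne_zero hC0 (ENNReal.coe_ne_zero.2 (mul_ne_zero ?_ ?_))
    · rw [ne_eq, map_eq_zero]; exact inv_ne_zero hp
    · rw [ne_eq, map_eq_zero]
      exact left_ne_zero_of_mul_eq_one (det_boxAd_mul_det_boxAd_inv p)
  refine integral_descConj_eq_smul_integral_levi_of_map_eq F (quotientMeasure T t hT ν)
    (quotientMeasure (T.subgroupOf M) t' (isClosed_subgroupOf T M hT) νM) κ μN hw0 (ENNReal.mul_ne_top hCtop ENNReal.coe_ne_top)
    p hpM hpT ?_ φ hφc hφi
  refine map_descConj_eq_smul_map_levi_of_forall_lintegral F (quotientMeasure T t hT ν)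
    (quotientMeasure (T.subgroupOf M) t' (isClosed_subgroupOf T M hT) νM) κ μN _ p hpM hpT fun Fn hFn => ?_
  rw [hdesc T hT hTM t t' ht' p hpM hpT hp Fn hFn, mul_assoc]

end Literature.NumberTheory.Automorphic

end
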